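import Summits.BirchSwinnertonDyer.BirchSwinnertonDyer.Theorems.SignedLowerHalvesKobayashiLowerHalfLargeImageKuriharaRigidityThm74Converse
import Summits.BirchSwinnertonDyer.Rank1Residual.Supersingular.GoodSSTowerOfSurj
import Literature.NumberTheory.EllipticCurves.CyclotomicIwasawaMainTheoremIrreducibleProofs
import HarnessLib

/-!
# Crux `KobayashiLowerHalfLargeImage` (item stmt-BirchSwinnertonDyer-19001), line `commonzero_squeeze` (crux dir
# `Cruxes/KobayashiLowerHalfLargeImage/Lines/commonzero_squeeze.lean`, NOT the registered line): its stub S1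
# «THE SIGN-BLIND KATO DEFECT» IN THE KERNEL — Kobayashi's proof of Thm. 7.4 made quantitative on the tree's
# `η = 1` packages (cell `bsd-ssimc`, seat `bsd-line-slh-p1-w2` g3; `--supports … --as helper`; closes nothing)

WHAT. Kobayashi 2003, proof of Thm. 7.4 (p. 13): the two exact sequences (7.21)
`0 → 𝐇¹(T)/Z → Λ/(L_p^ε) → X^ε → X₀ → 0` (`ε = ±`) SHARE the Kato module `𝐇¹(T)`, the zeta line `Z` and the
fine Selmer dual `X₀`. On characteristic ideals (this seat's four-term bookkeeping `charIdeal_mul_eq_of_fourTermExact`,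
p610687) they give, for EVERY sign `ε` and EVERY dual datum `D` of `Sel^ε(E/ℚ_∞)` with `char X^ε = (ξ)`,
`(ξ) · char(𝐇¹/Z) = (L_p^ε) · char(X₀)` — the right-hand normalisation `(Col^ε Z) = (ϖ·L_f^ε) = (L_f^ε)` because
the Néron/`Ω⁺_f` period ratio `ϖ` is a `p`-adic UNIT (Greenberg–Vatsal Rem. 3.4 / Mazur Cor. 4.1: the two period
facts). Kobayashi Thm. 4.1 (integral clause, under the `p`-adic tower which `GoodSS.towerSurj_of_surj` supplies from
`ρ̄` onto at a good supersingular `p`) gives `L_p⁺ = ξ₊·t`; cancelling the non-zero principal `(ξ₊)` in the domain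
`Λ` yields `char(𝐇¹/Z) = (t)·char(X₀)`, and then `(ξ_ε · t) = (L_p^ε)` for BOTH signs and every `D`: ONE
sign-blind `δ := t ∈ Λ` with `char X^ε · (δ) = (L_p^ε)`. So `δ ∣ gcd_Λ(L_p⁺, L_p⁻)`, `δ` is a unit iff Kato's /
either signed main conjecture holds — the lever of line `commonzero_squeeze` (card `Ideas/commonzero-squeeze.md`).

* §1 `charGen_mul_charIdeal_eq_of_signedColemanKato` — the per-sign identity on ONE package datum (any level `N`,
  `ord_p ϖ = 0` displayed, torsion of `X^ε` displayed; no named fact).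
* §2 `signBlindDefect_of_jointPackages` — S1's conclusion VERBATIM (`∃ δ, ∀ ε D, ∃ ξ, char X^ε = (ξ) ∧ (ξ·δ) = (L^ε)`)
  for `W` globally minimal, `p` odd good, `a_p = 0`, `ρ̄_{E,p}` onto, every cyclotomic frame, the newform at `N_E`,
  every Pollack pair — GRANTED Kobayashi Thm. 1.2 (`h12`), Thm. 4.1 (`h41`), the period facts (`h5`, `h3`) [PUBLISHED]
  and the JOINT package hypothesis `hJ` (displayed; = the body of the skeleton's typing request
  `JointSignedColemanKatoZeta`: the two `η = 1` packages can be chosen with `C₊.Z = C₋.Z`, Kato Thm. 12.6 being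
  sign-free in print).

READING FOR THE LEAD (L0 re-evaluation of `commonzero_squeeze`): S1 is kernel-closable, but AS FILED its signature
`(h12) (h41) (hL20) (hJ)` is MISSTATED — it must also take `h5`/`h3` (both already conjuncts of that line's S0
`stub_heldInputs`, so the composition `KobayashiLowerHalfLargeImage_of` is unaffected), since without `ord_p ϖ = 0`
the ideal `(Col^ε Z)` is `(ϖ·L_f^ε) ≠ (L_f^ε)`; and `hL20` (Wuthrich Lemma 20, semistable) is idle (X7 is
non-semistable; the tower comes from `GoodSS.towerSurj_of_surj`).

HONEST FRAMING (cell `bsd-ssimc`, D-0036/D-0074): TOOL THEOREMS ONLY — no definition, no named fact minted, no `sorry`,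
axioms standard; CONDITIONAL on the displayed named facts and on the joint-package hypothesis; the crux, every line
of it and the route are NOT closed; nothing is booked; BSD is not proved by any of this.
`--supports stmt-BirchSwinnertonDyer-19001 --as helper`.

References: [Kobayashi2003] Thm. 1.2, Thm. 4.1 (p. 8), Thm. 6.3 (p. 11), Thm. 7.3 i) (7.21), proof of Thm. 7.4
(p. 13); [Kato2004Asterisque] Thm. 12.4–12.6; [KuriharaPollack2007] §1.5 (p. 14); [GreenbergVatsal2000] §3 Rem. 3.4;
[Mazur1978] Cor. 4.1; [Wuthrich2014] Lemma 20; [NeukirchSchmidtWingberg2008] Ch. V §3.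
-/

set_option autoImplicit false
-- single-problem summit (D-0017): the doubled namespace component is by design
set_option linter.dupNamespace false

noncomputable section

open scoped Classical MatrixGroups ModularForm

open CongruenceSubgroup Field WeierstrassCurve Literature.NumberTheory.EllipticCurves
  Literature.NumberTheory.EllipticCurves.ModularForms Literature.NumberTheory.GaloisRepresentations
  Literature.NumberTheory.EllipticCurves.Rank1Residual Summit.BirchSwinnertonDyer.Rank1Residual.Supersingular
  Summit.BirchSwinnertonDyer.BirchSwinnertonDyer.Theorems.KuriharaRigidity

namespace Summit.BirchSwinnertonDyer.BirchSwinnertonDyer.Theorems.CommonZeroSqueeze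

/-! ## §1 The per-sign identity `(ξ)·char(𝐇¹/Z) = (L^ε)·char(X₀)` on one package datum -/

section Frame

variable (W : WeierstrassCurve ℚ) [W.IsElliptic] [W.IsGloballyMinimal] (p : ℕ) [Fact p.Prime]
  [ContinuousSMul ℤ_[p] (W.tateModule p)] [Module.Free ℤ_[p] (W.tateModule p)]
  [Module.Finite ℤ_[p] (W.tateModule p)]

omit [W.IsGloballyMinimal] in
/-- **(7.21) on characteristic ideals, one sign**: for a newform `f` of `W` (any level), a period ratio `ϖ`
with `ord_p ϖ = 0`, a Pollack pair, a TORSION dual datum `D` of `Sel^ε(E/ℚ_∞)`, a pinned fine dual `Y` and a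
sign-`ε` package datum `d` on a pinned `I`, at an odd good `p` with `a_p = 0` and `E[p]` irreducible:
`char X^ε = (ξ)` is principal and `(ξ) · char_Λ(I.H ⧸ d.Z) = (L^ε) · char_Λ(Y.X)` with `L^ε = kobayashiL ε L⁺ L⁻`
(the `Ω⁺_f`-normalised function: `char(Λ/col Z) = (C(u)·L^ε) = (L^ε)`, `u ∈ ℤ_pˣ`). Proof: the seat's
`fourTerm_data_of_signedColemanKato_of_isTorsion` + `charIdeal_mul_eq_of_fourTermExact`. No named fact.
[cite: Kobayashi2003, Thm. 7.3 i) (7.21) and proof of Thm. 7.4 (p. 13), Thm. 6.3 (p. 11)]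
[cite: NeukirchSchmidtWingberg2008, Ch. V §3] -/
theorem charGen_mul_charIdeal_eq_of_signedColemanKato
    (hirr : W.HasIrreducibleModPGaloisRep p) {ε : ℤˣ}
    {κ : ZpExtension ℚ p} {γ : absoluteGaloisGroup ℚ} (hγ : κ.IsTopGenerator γ)
    {N : ℕ} [NeZero N] {f : CuspForm (Gamma0 N) 2} (hf : IsNewformOf W f)
    {ϖ : ℚ} (hϖ : (ϖ : ℝ) * W.realPeriodRat = plusPeriod f) (hvϖ : padicValRat p ϖ = 0)
    {Lplus Lminus : IwasawaAlgebra p} (hL : IsPollackPair f p Lplus Lminus)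
    (D : Kobayashi2003.SignedSelmerDualData W κ γ ε) (hDtor : Module.IsTorsion (IwasawaAlgebra p) D.X)
    {I : Kato2004.IwasawaH1Data W p κ γ}
    (Y : W.FineSelmerDualData κ γ) (d : Kobayashi2003.SignedColemanKatoData W p f ϖ κ γ ε I) :
    ∃ ξ : IwasawaAlgebra p, D.charIdeal = Ideal.span {ξ} ∧
      Ideal.span {ξ} * Module.charIdeal (IwasawaAlgebra p) (I.H ⧸ d.Z) =
        Ideal.span {kobayashiL ε Lplus Lminus} * Module.charIdeal (IwasawaAlgebra p) Y.X := by
  haveI : Module.Finite (IwasawaAlgebra p) Y.X :=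
    WeierstrassCurve.FineSelmerDualData.module_finite _ κ hγ Y
  obtain ⟨hYtor, G₁, hG₁0, hG₁, hcharJ, hQtor, i, j', k', hi, hij, hjk', hk'⟩ :=
    fourTerm_data_of_signedColemanKato_of_isTorsion W p hirr hf hϖ hvϖ hL D hDtor Y d
  obtain ⟨e1, e2⟩ := charIdeal_mul_eq_of_fourTermExact hQtor hYtor i j' k' hi hij hjk' hk'
  -- `(G₁) = (L^ε)`: `G₁ = C(u)·L^ε` with `u ∈ ℤ_pˣ`, `(u : ℚ_p) = ϖ`
  set L : IwasawaAlgebra p := kobayashiL ε Lplus Lminus with hLdef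
  have hϖ0 : ϖ ≠ 0 := by
    rintro rfl
    rw [Rat.cast_zero, zero_mul] at hϖ
    exact (IsNewform0.plusPeriod_pos_holds hf.1 hf.coeffField_eq_bot).ne hϖ
  obtain ⟨u, hu⟩ := exists_units_coe_eq_ratCast hϖ0 hvϖ
  have hCuL : iwasawaToPowerSeries p (PowerSeries.C (u : ℤ_[p]) * L) =
      PowerSeries.C (((ϖ : ℚ) : ℚ_[p])) * iwasawaToPowerSeries p L := by
    rw [map_mul, ← hu]
    congr 1
    rw [PowerSeries.map_C]
    rfl
  have hG₁eq : G₁ = PowerSeries.C (u : ℤ_[p]) * L :=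
    iwasawaToPowerSeries_injective p (hG₁.trans hCuL.symm)
  have hGL : Ideal.span {G₁} = Ideal.span {L} := by
    rw [hG₁eq]
    exact Ideal.span_singleton_mul_left_unit ((Units.isUnit u).map PowerSeries.C) L
  -- `char X^ε = (ξ)` is principal
  obtain ⟨ξ, hξ⟩ := (charIdeal_isPrincipal_holds p D.X).principal
  have hξ' : Module.charIdeal (IwasawaAlgebra p) D.X = Ideal.span {ξ} := hξ
  refine ⟨ξ, hξ', ?_⟩
  calc Ideal.span {ξ} * Module.charIdeal (IwasawaAlgebra p) (I.H ⧸ d.Z)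
      = Module.charIdeal (IwasawaAlgebra p) D.X * Module.charIdeal (IwasawaAlgebra p) (I.H ⧸ d.Z) := by
        rw [hξ']
    _ = (Module.charIdeal (IwasawaAlgebra p) (I.H ⧸ d.Z) *
          Module.charIdeal (IwasawaAlgebra p) (LinearMap.range j')) *
          Module.charIdeal (IwasawaAlgebra p) Y.X := by
        rw [e2]; ring
    _ = Ideal.span {L} * Module.charIdeal (IwasawaAlgebra p) Y.X := by
        rw [← e1, hcharJ, hGL]

end Frame

/-! ## §2 S1 of line `commonzero_squeeze`: the sign-blind Kato defect `δ` -/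

/-- **THE SIGN-BLIND KATO DEFECT (line `commonzero_squeeze`, stub S1 — conclusion verbatim).** For `W/ℚ` globally
minimal, `p` ODD good with `a_p = 0` and `ρ̄_{E,p}` onto, every cyclotomic frame `(κ, γ)` matching the variable,
the newform `f` at level `N_E` and every Pollack pair `(L⁺, L⁻)`: there is ONE `δ ∈ Λ` such that for BOTH signs
`ε` and EVERY dual datum `D` of `Sel^ε(E/ℚ_∞)`, `char X^ε = (ξ)` with `(ξ·δ) = (L_p^ε)` (Kobayashi's labelling
`kobayashiL`). GRANTED, by name: Kobayashi Thm. 1.2 (`h12`, torsion + finiteness of `X^ε`), Thm. 4.1 (`h41`, its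
integral clause `L_p^ε ∈ char X^ε` under the `p`-adic tower — supplied by `GoodSS.towerSurj_of_surj` from `ρ̄`
onto), the period facts (`h5` at `p ≥ 5`, `h3` at `p = 3`: `ord_p(Ω⁺_f/Ω_E) = 0`) [all PUBLISHED]; and the
DISPLAYED joint-package hypothesis `hJ` (the two `η = 1` packages of Kobayashi Thm. 6.2/6.3/7.3 i) + Kato 12.6
chosen on ONE zeta submodule, `C₊.Z = C₋.Z` — the body of the skeleton's typing request `JointSignedColemanKatoZeta`,
verbatim; Kato's `Z(T) = Λ·z` is sign-free in print). Proof: pin `I`, `Y`; §1 for a sign-`+1` datum `D₀` gives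
`(ξ₀)·char(𝐇¹/Z) = (L⁺)·char(X₀)`, Thm. 4.1 gives `L⁺ = ξ₀·t`, so `char(𝐇¹/Z) = (t)·char(X₀)` (cancel `(ξ₀) ≠ 0`);
then §1 for any `(ε, D)` on the package of sign `ε` (same `Z`) and cancellation of `char(X₀) ≠ 0` give
`(ξ·t) = (L^ε)`. CONDITIONAL on the named facts and `hJ`; closes nothing; BSD is not proved by this.
[cite: Kobayashi2003, proof of Thm. 7.4 (p. 13), Thm. 7.3 i) (7.21), Thm. 4.1 (p. 8), Thm. 1.2 (p. 2)]
[cite: Kato2004Asterisque, Thm. 12.6 (p. 222)] [cite: KuriharaPollack2007, §1.5 (p. 14)]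
[cite: GreenbergVatsal2000, §3, Remark 3.4] [cite: Mazur1978, Cor. 4.1] [cite: Wuthrich2014, Lemma 20 (p. 399)] -/
theorem signBlindDefect_of_jointPackages
    (h12 : Kobayashi2003.thm12_signedSelmerDual_finite_torsion)
    (h41 : Kobayashi2003.thm41_signedCharIdeal_divisibility)
    (h5 : realPeriodRat_eq_unit_mul_plusPeriod) (h3 : realPeriodRat_eq_unit_mul_plusPeriod_three)
    (hJ : ∀ (W : WeierstrassCurve ℚ) [W.IsElliptic] [W.IsGloballyMinimal] (p : ℕ) [Fact p.Prime]
      [ContinuousSMul ℤ_[p] (W.tateModule p)] [Module.Free ℤ_[p] (W.tateModule p)]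
      [Module.Finite ℤ_[p] (W.tateModule p)] {N : ℕ} [NeZero N] (f : CuspForm (Gamma0 N) 2) (ϖ : ℚ)
      (κ : ZpExtension ℚ p) (γ : Field.absoluteGaloisGroup ℚ),
      p ≠ 2 → W.HasGoodReductionAtPrime p → W.frobeniusTrace p = 0 → IsNewformOf W f →
      (ϖ : ℝ) * W.realPeriodRat = plusPeriod f →
      κ.IsCyclotomic → κ.IsTopGenerator γ → IsCyclotomicVariable p γ →
      ∀ (I : Kato2004.IwasawaH1Data W p κ γ),
        ∃ (Cp : Kobayashi2003.SignedColemanKatoData W p f ϖ κ γ 1 I)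
          (Cm : Kobayashi2003.SignedColemanKatoData W p f ϖ κ γ (-1) I), Cp.Z = Cm.Z) :
    ∀ (W : WeierstrassCurve ℚ) [W.IsElliptic] [W.IsGloballyMinimal] (p : ℕ) [Fact p.Prime],
      p ≠ 2 → W.HasGoodReductionAtPrime p → W.frobeniusTrace p = 0 → Surj W p →
    ∀ (κ : ZpExtension ℚ p) (γ : Field.absoluteGaloisGroup ℚ),
      κ.IsCyclotomic → κ.IsTopGenerator γ → IsCyclotomicVariable p γ →
    ∀ [NeZero (W.conductorNorm ℤ)] (f : CuspForm (Gamma0 (W.conductorNorm ℤ)) 2), IsNewformOf W f →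
    ∀ (Lplus Lminus : IwasawaAlgebra p), IsPollackPair f p Lplus Lminus →
      ∃ δ : IwasawaAlgebra p, ∀ (ε : ℤˣ) (D : Kobayashi2003.SignedSelmerDualData W κ γ ε),
        ∃ ξ : IwasawaAlgebra p, D.charIdeal = Ideal.span {ξ} ∧
          Ideal.span {ξ * δ} = Ideal.span {kobayashiL ε Lplus Lminus} := by
  intro W _ _ p _ hp2 hgood hap hs κ γ hκ hγ hγc _ f hf Lplus Lminus hL
  have hpP : p.Prime := Fact.out
  haveI : ContinuousSMul ℤ_[p] (W.tateModule p) := TateModule.continuousSMul_padicInt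
  haveI : Module.Free ℤ_[p] (W.tateModule p) := W.module_free_tateModule_holds p
  haveI : Module.Finite ℤ_[p] (W.tateModule p) := W.module_finite_tateModule_holds p
  have hirr : W.HasIrreducibleModPGaloisRep p :=
    hasIrreducibleModPGaloisRep_of_hasSurjectiveModNGaloisRep W p hs
  -- the `p`-adic tower from `ρ̄` onto at a good supersingular prime (Thm. 4.1's integral clause)
  have hss : GoodSS W p := ⟨hgood, by rw [hap]; exact dvd_zero _⟩
  have htower : ∀ m : ℕ, W.HasSurjectiveModNGaloisRep (p ^ m : ℕ) :=
    fun m => GoodSS.towerSurj_of_surj W p hp2 hss hs m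
  -- the period ratio `ϖ = u⁻¹`, a `p`-adic unit (Greenberg–Vatsal / Mazur)
  have hper : ∃ u : ℚ, ‖(u : ℚ_[p])‖ = 1 ∧ W.realPeriodRat = u * plusPeriod f := by
    rcases Nat.lt_or_ge p 5 with hlt | hge
    · have h2 := hpP.two_le
      have hp3 : p = 3 := by
        interval_cases p
        · exact absurd rfl hp2
        · rfl
        · exact absurd hpP (by decide)
      subst hp3
      exact h3 W hgood hirr f hf
    · exact h5 W p hge hgood hirr f hf
  obtain ⟨u, hu1, hu⟩ := hper
  have hu0 : u ≠ 0 := by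
    rintro rfl
    simp at hu1
  have hϖ : ((u⁻¹ : ℚ) : ℝ) * W.realPeriodRat = plusPeriod f := by
    rw [hu, Rat.cast_inv, ← mul_assoc, inv_mul_cancel₀ (by exact_mod_cast hu0), one_mul]
  have hvϖ : padicValRat p (u⁻¹ : ℚ) = 0 := by
    rw [padicValRat.inv, padicValRat_eq_zero_of_norm_ratCast_eq_one hu1, neg_zero]
  -- pin `𝐇¹_Γ(T_pW)`, `X₀(W/ℚ_∞)`; the JOINT packages on one zeta submodule
  obtain ⟨I⟩ := Kato2004.nonempty_iwasawaH1Data_holds W p κ γ hκ hγ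
  obtain ⟨Y⟩ := W.nonempty_fineSelmerDualData κ hγ
  obtain ⟨dp, dm, hZ⟩ := hJ W p f (u⁻¹ : ℚ) κ γ hp2 hgood hap hf hϖ hκ hγ hγc I
  -- abbreviations: `A = char(𝐇¹/Z)`, `B = char(X₀) = (β)`, `β ≠ 0`
  set A : Ideal (IwasawaAlgebra p) := Module.charIdeal (IwasawaAlgebra p) (I.H ⧸ dp.Z) with hAdef
  have hAm : Module.charIdeal (IwasawaAlgebra p) (I.H ⧸ dm.Z) = A := by
    rw [hAdef, hZ]
  obtain ⟨β, hβ⟩ := (charIdeal_isPrincipal_holds p Y.X).principal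
  have hB : Module.charIdeal (IwasawaAlgebra p) Y.X = Ideal.span {β} := hβ
  have hβ0 : β ≠ 0 := by
    intro h0
    exact Module.charIdeal_ne_bot (IwasawaAlgebra p) Y.X (by rw [hB, h0, Ideal.span_singleton_eq_bot])
  -- Kobayashi's `L^ε ≠ 0`
  have hLne : ∀ ε : ℤˣ, kobayashiL ε Lplus Lminus ≠ 0 := by
    intro ε
    unfold kobayashiL
    split_ifs
    · exact hL.2.1
    · exact hL.1
  -- the per-sign identity on the package of sign `ε` (same `Z`)
  have hid : ∀ (ε : ℤˣ) (D : Kobayashi2003.SignedSelmerDualData W κ γ ε),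
      ∃ ξ : IwasawaAlgebra p, ξ ≠ 0 ∧ D.charIdeal = Ideal.span {ξ} ∧
        Ideal.span {ξ} * A = Ideal.span {kobayashiL ε Lplus Lminus} * Ideal.span {β} := by
    intro ε D
    obtain ⟨hfin, htor⟩ := h12 W p hp2 hgood hap κ γ hκ hγ ε D
    have key : ∃ ξ : IwasawaAlgebra p, D.charIdeal = Ideal.span {ξ} ∧
        Ideal.span {ξ} * A = Ideal.span {kobayashiL ε Lplus Lminus} * Ideal.span {β} := by
      rcases Int.units_eq_one_or ε with rfl | rfl
      · obtain ⟨ξ, hξ, h⟩ := charGen_mul_charIdeal_eq_of_signedColemanKato W p hirr hγ hf hϖ hvϖ hL D htor Y dp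
        exact ⟨ξ, hξ, by rw [← hB]; exact h⟩
      · obtain ⟨ξ, hξ, h⟩ := charGen_mul_charIdeal_eq_of_signedColemanKato W p hirr hγ hf hϖ hvϖ hL D htor Y dm
        exact ⟨ξ, hξ, by rw [← hAm, ← hB]; exact h⟩
    obtain ⟨ξ, hξ, h⟩ := key
    refine ⟨ξ, ?_, hξ, h⟩
    rintro rfl
    rw [Ideal.span_singleton_eq_bot.mpr rfl, Ideal.bot_mul, eq_comm, Ideal.mul_eq_bot,
      Ideal.span_singleton_eq_bot, Ideal.span_singleton_eq_bot] at h
    exact h.elim (hLne ε) hβ0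
  -- Kato's inclusion from Thm. 4.1 at ONE sign-`+1` datum: `A = (t)·(β)` with `L⁺ = t·ξ₀`
  obtain ⟨D₀⟩ := Kobayashi2003.nonempty_signedSelmerDualData W κ (1 : ℤˣ) hγ
  obtain ⟨hfin₀, htor₀⟩ := h12 W p hp2 hgood hap κ γ hκ hγ 1 D₀
  haveI := hfin₀
  obtain ⟨ξ₀, hξ₀0, hξ₀, hid₀⟩ := hid 1 D₀
  have hLmem : kobayashiL 1 Lplus Lminus ∈ D₀.charIdeal :=
    (h41 W p hp2 hgood hap f hf κ γ hκ hγ hγc 1 (kobayashiL 1 Lplus Lminus)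
      (hL.isSignedPAdicLFunction_kobayashiL 1) D₀ htor₀).2 htower
  rw [hξ₀] at hLmem
  obtain ⟨t, ht⟩ := Ideal.mem_span_singleton'.mp hLmem
  have hAt : A = Ideal.span {t} * Ideal.span {β} := by
    apply (Ideal.span_singleton_mul_right_inj hξ₀0).mp
    rw [hid₀, ← ht]
    simp only [Ideal.span_singleton_mul_span_singleton]
    rw [show t * ξ₀ * β = ξ₀ * (t * β) from by ring]
  -- `δ := t` serves both signs and every dual datum
  refine ⟨t, fun ε D => ?_⟩
  obtain ⟨ξ, -, hξ, h⟩ := hid ε D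
  refine ⟨ξ, hξ, ?_⟩
  have h' : Ideal.span {β} * Ideal.span {ξ * t} = Ideal.span {β} * Ideal.span {kobayashiL ε Lplus Lminus} := by
    rw [← Ideal.span_singleton_mul_span_singleton, mul_comm (Ideal.span {β}), mul_assoc, ← hAt, h, mul_comm]
  exact (Ideal.span_singleton_mul_right_inj hβ0).mp h'

end Summit.BirchSwinnertonDyer.BirchSwinnertonDyer.Theorems.CommonZeroSqueeze

end
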